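import Summits.RiemannHypothesis.RiemannHypothesis.Theorems.PfPersistenceFfWeilCriterion
import Mathlib.FieldTheory.KummerExtension
import Mathlib.RingTheory.RootsOfUnity.Complex

/-!
# Function-field mirror — the all-genus sharpness family: roots and kernel (door D-D, part 1/2)

pub-rhpf campaign, function-field mirror seat 2 (separation analysis); mechanism/rigidity campaign —
**no RH claims**.  Companion of `PfPersistenceFfWeilCriterion` (the finite Weil criterion
`T_{2g-1}(q,h) ⪰ 0 ↔ RH(q,h)` for FE-honest data of degree `2g`) and of the kernel witnesses
`PfPersistenceFfWeilCriterionSharp` (`g = 2`), `…SharpG3/G4/G5` (`g = 3, 4, 5` at `q = 10⁴`).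

Here the per-`g` existential is settled for ALL `g` at once by an explicit two-parameter family:
for `g = g' + 1 ≥ 1` and `k ≥ max(1, 8g')` put `m = k(k+1)`, `q = m²` and
`h = (x - k²)(x - (k+1)²) · (x^{2g-1} - m^{2g-1})/(x - m)  ∈ ℤ[x]`
(`hAll g' k`; the last factor is `geomFactor m (2g')`).  Its roots are `k², (k+1)²` (a REAL reciprocal
pair OFF the circle `|α| = m`) and `m ζ^j`, `1 ≤ j ≤ 2g-2`, `ζ = e^{2πi/(2g-1)}` (on the circle), so the
normalised power sums are `s_d/m^d = r₊^d + r₋^d - 1` for `1 ≤ d ≤ 2g-2` (`r₊ = (k+1)/k = 1/r₋`), and the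
window form of depth `2g-2` is `T = ((2g-1)/2)·1 + ½·J + ½·(e(|i-j|))` with
`0 ≤ e(d) = r₊^d + r₋^d - 2 ≤ 1/3` on the window (Bernoulli: `(1+1/k)^{2g-2} ≤ 4/3` for `k ≥ 8(g-1)`),
whence `x*Tx ≥ ((2g-1)/3)|x|² ≥ 0` (part 2, `…SharpAll`).  THIS FILE: the polynomial `hAll`, its
root multiset, degree, `h(0) ≠ 0`, root-side FE, failure of RH, and the ENTRY FORMULA
`windowForm_all_apply` of the depth-`2g-2` window form.

Honest scope.  (i) `q = (k(k+1))²` is an integer but NOT a prime power (except `k = 1`, `q = 4`, the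
`g = 2` witness of `…Sharp`); every door statement in this chain quantifies over real `q > 0` /
natural `q`, and an RH-false `h` is never the `L`-polynomial of a curve anyway (Weil), so the model class
is "FE-honest reciprocal integer polynomial with parameter `q`" throughout.  A prime-power variant
(`m = 2^t`, off-circle factor `x² - (2m+1)x + m²`) follows from the same estimate but is not formalised
here.  (ii) "FE-honest" is the root-side reading used by the criterion (roots closed under `α ↦ q/α`,
`0` not a root).  (iii) Nothing here bears on the number-field side.  All statements are exact
(`ℤ[x]`, cyclotomic and rational arithmetic); tags `[folklore]`.
-/

set_option linter.dupNamespace false  -- the mandated namespace repeats `RiemannHypothesis`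

noncomputable section

open Polynomial Matrix Finset
open scoped ComplexOrder ComplexConjugate

namespace Summit.RiemannHypothesis.RiemannHypothesis.Theorems.PfPersistence.FfAngleTwin

/-- The primitive `N`-th root of unity `e^{2πi/N}`. [folklore] -/
def zetaN (N : ℕ) : ℂ := Complex.exp (2 * Real.pi * Complex.I / N)

/-- `e^{2πi/N}` is a primitive `N`-th root of unity. [folklore] -/
theorem zetaN_isPrimitiveRoot {N : ℕ} (hN : N ≠ 0) : IsPrimitiveRoot (zetaN N) N :=
  Complex.isPrimitiveRoot_exp N hN

/-- `ζ_N^N = 1`. [folklore] -/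
theorem zetaN_pow_self (N : ℕ) (hN : N ≠ 0) : zetaN N ^ N = 1 :=
  (zetaN_isPrimitiveRoot hN).pow_eq_one

/-- `ζ_N ≠ 0`. [folklore] -/
theorem zetaN_ne_zero {N : ℕ} (hN : N ≠ 0) : zetaN N ≠ 0 :=
  (zetaN_isPrimitiveRoot hN).ne_zero hN

/-- The non-trivial `(n+1)`-th roots of unity `ζ^{i+1}`, `i < n`. [folklore] -/
def unitRoots (n : ℕ) : Multiset ℂ := (Finset.range n).val.map fun i => zetaN (n + 1) ^ (i + 1)

/-- The geometric factor `Σ_{j ≤ n} m^{n-j} x^j = (x^{n+1} - m^{n+1})/(x - m)`. [folklore] -/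
def geomFactor (m n : ℕ) : ℤ[X] := ∑ j ∈ Finset.range (n + 1), C ((m : ℤ) ^ (n - j)) * X ^ j

/-- `geomFactor m n · (x - m) = x^{n+1} - m^{n+1}` over `ℂ`. [folklore] -/
theorem geomFactor_map_mul (m n : ℕ) :
    (geomFactor m n).map (Int.castRingHom ℂ) * (X - C (m : ℂ)) = X ^ (n + 1) - C ((m : ℂ) ^ (n + 1)) := by
  have hsum : (geomFactor m n).map (Int.castRingHom ℂ) =
      ∑ i ∈ Finset.range (n + 1), X ^ i * (C (m : ℂ)) ^ (n + 1 - 1 - i) := by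
    unfold geomFactor
    rw [Polynomial.map_sum]
    refine Finset.sum_congr rfl fun j _ => ?_
    simp only [Polynomial.map_mul, Polynomial.map_pow, Polynomial.map_X, Polynomial.map_C]
    simp only [map_pow, Int.coe_castRingHom, Int.cast_natCast, Nat.add_sub_cancel]
    ring
  rw [hsum, geom_sum₂_mul, map_pow]

/-- `x^{n+1} - m^{n+1} = Π_{i < n} (x - ζ^{i+1} m) · (x - m)` over `ℂ`, `ζ = e^{2πi/(n+1)}`. [folklore] -/
theorem X_pow_sub_C_pow_eq (m n : ℕ) :
    (X : ℂ[X]) ^ (n + 1) - C ((m : ℂ) ^ (n + 1)) =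
      (∏ i ∈ Finset.range n, (X - C ((m : ℂ) * zetaN (n + 1) ^ (i + 1)))) * (X - C (m : ℂ)) := by
  rw [X_pow_sub_C_eq_prod (zetaN_isPrimitiveRoot (Nat.succ_ne_zero n)) (Nat.succ_pos n) rfl,
    Finset.prod_range_succ']
  simp [mul_comm]

/-- The geometric factor splits: `geomFactor m n = Π_{i<n} (x - m ζ^{i+1})` over `ℂ`. [folklore] -/
theorem geomFactor_map (m n : ℕ) :
    (geomFactor m n).map (Int.castRingHom ℂ) =
      ∏ i ∈ Finset.range n, (X - C ((m : ℂ) * zetaN (n + 1) ^ (i + 1))) := by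
  have h := geomFactor_map_mul m n
  rw [X_pow_sub_C_pow_eq] at h
  exact mul_right_cancel₀ (X_sub_C_ne_zero (m : ℂ)) h

/-- The root multiset of the geometric factor: `m ζ^{i+1}`, `i < n`. [folklore] -/
def geomRoots (m n : ℕ) : Multiset ℂ := (unitRoots n).map fun u => (m : ℂ) * u

/-- The geometric factor as `Π (x - w)` over its root multiset. [folklore] -/
theorem geomFactor_map_eq_prod (m n : ℕ) :
    (geomFactor m n).map (Int.castRingHom ℂ) = ((geomRoots m n).map fun w => X - C w).prod := by
  rw [geomFactor_map, geomRoots, unitRoots, Multiset.map_map, Multiset.map_map, Finset.prod_eq_multiset_prod]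
  rfl

/-- Two multisets with the same `Π (x - w)` are equal. [folklore] -/
theorem multiset_eq_of_prod_X_sub_C_eq {A B : Multiset ℂ}
    (h : (A.map fun w => X - C w).prod = (B.map fun w => X - C w).prod) : A = B := by
  simpa using congrArg Polynomial.roots h

/-- The geometric roots are closed under `α ↦ m²/α`. [folklore] -/
theorem geomRoots_reciprocal (m n : ℕ) (hm : m ≠ 0) :
    ((geomRoots m n).map fun α => (m : ℂ) ^ 2 / α) = geomRoots m n := by
  have hmne : (m : ℂ) ≠ 0 := by exact_mod_cast hm
  have hζ : zetaN (n + 1) ≠ 0 := zetaN_ne_zero (Nat.succ_ne_zero n)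
  apply multiset_eq_of_prod_X_sub_C_eq
  rw [geomRoots, unitRoots, Multiset.map_map, Multiset.map_map, Multiset.map_map, Multiset.map_map,
    Multiset.map_map, ← Finset.prod_eq_multiset_prod, ← Finset.prod_eq_multiset_prod]
  conv_rhs => rw [← Finset.prod_range_reflect]
  refine Finset.prod_congr rfl fun i hi => ?_
  rw [Finset.mem_range] at hi
  have hz : zetaN (n + 1) ^ (i + 1) * zetaN (n + 1) ^ (n - 1 - i + 1) = 1 := by
    rw [← pow_add, show i + 1 + (n - 1 - i + 1) = n + 1 by omega, zetaN_pow_self _ (Nat.succ_ne_zero n)]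
  have key : (m : ℂ) ^ 2 / ((m : ℂ) * zetaN (n + 1) ^ (i + 1)) = (m : ℂ) * zetaN (n + 1) ^ (n - 1 - i + 1) := by
    rw [div_eq_iff (mul_ne_zero hmne (pow_ne_zero _ hζ))]
    linear_combination (-(m : ℂ) ^ 2) * hz
  simp only [Function.comp_apply]
  rw [key]

/-- The all-`g` sharpness polynomial (`g = g' + 1`, parameter `k`, `m = k(k+1)`, `q = m²`):
`h = (x - k²)(x - (k+1)²) · Σ_{j ≤ 2g'} m^{2g'-j} x^j`. [folklore] -/
def hAll (g' k : ℕ) : ℤ[X] :=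
  (X - C ((k : ℤ) ^ 2)) * (X - C (((k : ℤ) + 1) ^ 2)) * geomFactor (k * (k + 1)) (2 * g')

/-- The parameter `q = (k(k+1))²`. [folklore] -/
def qAll (k : ℕ) : ℕ := (k * (k + 1)) ^ 2

/-- The complex roots of `hAll`: `k², (k+1)²` and `m ζ^{j}`, `1 ≤ j ≤ 2g'`, `ζ = e^{2πi/(2g'+1)}`. [folklore] -/
def rootsAll (g' k : ℕ) : Multiset ℂ :=
  ((k : ℂ) ^ 2) ::ₘ (((k : ℂ) + 1) ^ 2) ::ₘ geomRoots (k * (k + 1)) (2 * g')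

/-- `hAll` splits over `ℂ` with root multiset `rootsAll`. [folklore] -/
theorem map_hAll (g' k : ℕ) :
    (hAll g' k).map (Int.castRingHom ℂ) = ((rootsAll g' k).map fun w => X - C w).prod := by
  have e1 : (X - C ((k : ℤ) ^ 2)).map (Int.castRingHom ℂ) = X - C ((k : ℂ) ^ 2) := by simp
  have e2 : (X - C (((k : ℤ) + 1) ^ 2)).map (Int.castRingHom ℂ) = X - C (((k : ℂ) + 1) ^ 2) := by simp
  rw [hAll, Polynomial.map_mul, Polynomial.map_mul, geomFactor_map_eq_prod, e1, e2, rootsAll,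
    Multiset.map_cons, Multiset.map_cons, Multiset.prod_cons, Multiset.prod_cons, mul_assoc]

/-- The complex roots of `hAll g' k` are `rootsAll g' k`. [folklore] -/
theorem frobRoots_hAll (g' k : ℕ) : frobRoots (hAll g' k) = rootsAll g' k := by
  unfold frobRoots
  rw [map_hAll, roots_multiset_prod_X_sub_C]

/-- `#rootsAll = 2g' + 2 = 2g`. [folklore] -/
theorem card_rootsAll (g' k : ℕ) : Multiset.card (rootsAll g' k) = 2 * g' + 2 := by
  simp [rootsAll, geomRoots, unitRoots]

/-- `deg hAll = 2g`. [folklore] -/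
theorem natDegree_hAll (g' k : ℕ) : (hAll g' k).natDegree = 2 * (g' + 1) := by
  rw [← card_frobRoots_eq_natDegree, frobRoots_hAll, card_rootsAll]
  ring

/-- `h(0) ≠ 0`: zero is not a root (`k ≥ 1`). [folklore] -/
theorem zero_not_mem_rootsAll (g' : ℕ) {k : ℕ} (hk : k ≠ 0) : (0 : ℂ) ∉ rootsAll g' k := by
  have hkne : (k : ℂ) ≠ 0 := by exact_mod_cast hk
  have hk1 : (k : ℂ) + 1 ≠ 0 := by exact_mod_cast Nat.succ_ne_zero k
  have hm : ((k * (k + 1) : ℕ) : ℂ) ≠ 0 := by push_cast; exact mul_ne_zero hkne hk1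
  have hζ : zetaN (2 * g' + 1) ≠ 0 := zetaN_ne_zero (Nat.succ_ne_zero _)
  simp only [rootsAll, geomRoots, unitRoots, Multiset.mem_cons, Multiset.mem_map, Finset.mem_val,
    Finset.mem_range]
  push Not
  refine ⟨(pow_ne_zero 2 hkne).symm, (pow_ne_zero 2 hk1).symm, ?_⟩
  rintro u ⟨i, _, rfl⟩
  exact mul_ne_zero hm (pow_ne_zero _ hζ)

/-- FE (root side): the roots are closed under `α ↦ q/α`, `q = (k(k+1))²`. [folklore] -/
theorem rootsAll_reciprocal (g' : ℕ) {k : ℕ} (hk : k ≠ 0) :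
    (rootsAll g' k).map (fun α => ((k * (k + 1) : ℕ) : ℂ) ^ 2 / α) = rootsAll g' k := by
  have hkne : (k : ℂ) ≠ 0 := by exact_mod_cast hk
  have hk1 : (k : ℂ) + 1 ≠ 0 := by exact_mod_cast Nat.succ_ne_zero k
  have e1 : ((k * (k + 1) : ℕ) : ℂ) ^ 2 / (k : ℂ) ^ 2 = ((k : ℂ) + 1) ^ 2 := by
    push_cast; field_simp
  have e2 : ((k * (k + 1) : ℕ) : ℂ) ^ 2 / ((k : ℂ) + 1) ^ 2 = (k : ℂ) ^ 2 := by
    push_cast; field_simp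
  rw [rootsAll, Multiset.map_cons, Multiset.map_cons, e1, e2,
    geomRoots_reciprocal _ _ (Nat.mul_ne_zero hk (Nat.succ_ne_zero k)), Multiset.cons_swap]

/-- `√q = k(k+1)`. [folklore] -/
theorem sqrt_qAll (k : ℕ) : Real.sqrt (qAll k : ℝ) = (k : ℝ) * (k + 1) := by
  rw [qAll, Nat.cast_pow, Real.sqrt_sq (by positivity)]
  push_cast; ring

/-- RH FAILS: the root `(k+1)²` has modulus `≠ √q`. [folklore] -/
theorem not_rh_rootsAll (g' k : ℕ) : ¬ (∀ α ∈ rootsAll g' k, ‖α‖ = Real.sqrt (qAll k : ℝ)) := by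
  intro h
  have hmem : (((k : ℂ) + 1) ^ 2) ∈ rootsAll g' k := by simp [rootsAll]
  have := h _ hmem
  rw [sqrt_qAll, norm_pow, show (k : ℂ) + 1 = ((k + 1 : ℝ) : ℂ) by push_cast; ring, Complex.norm_real,
    Real.norm_eq_abs, abs_of_nonneg (by positivity)] at this
  nlinarith

/-! ## The kernel of the all-`g` witness -/

/-- `r₊ = (k+1)/k` and `r₋ = k/(k+1)`: the normalised off-circle pair. [folklore] -/
def rPlus (k : ℕ) : ℝ := ((k : ℝ) + 1) / k

/-- `r₋ = k/(k+1)`. [folklore] -/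
def rMinus (k : ℕ) : ℝ := (k : ℝ) / (k + 1)

/-- `r₊ r₋ = 1`. [folklore] -/
theorem rPlus_mul_rMinus {k : ℕ} (hk : k ≠ 0) : rPlus k * rMinus k = 1 := by
  have : (k : ℝ) ≠ 0 := by exact_mod_cast hk
  rw [rPlus, rMinus]; field_simp

/-- The normalised roots: `r₋, r₊` and the non-trivial `(2g-1)`-th roots of unity. [folklore] -/
theorem normRoots_rootsAll (g' : ℕ) {k : ℕ} (hk : k ≠ 0) :
    normRoots (qAll k : ℝ) (rootsAll g' k) =
      ((rMinus k : ℝ) : ℂ) ::ₘ ((rPlus k : ℝ) : ℂ) ::ₘ unitRoots (2 * g') := by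
  have hkne : (k : ℂ) ≠ 0 := by exact_mod_cast hk
  have hk1 : (k : ℂ) + 1 ≠ 0 := by exact_mod_cast Nat.succ_ne_zero k
  unfold normRoots
  rw [sqrt_qAll, rootsAll, Multiset.map_cons, Multiset.map_cons, geomRoots, Multiset.map_map]
  have e1 : (k : ℂ) ^ 2 / (((k : ℝ) * (k + 1) : ℝ) : ℂ) = ((rMinus k : ℝ) : ℂ) := by
    rw [rMinus]; push_cast; field_simp
  have e2 : ((k : ℂ) + 1) ^ 2 / (((k : ℝ) * (k + 1) : ℝ) : ℂ) = ((rPlus k : ℝ) : ℂ) := by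
    rw [rPlus]; push_cast; field_simp
  rw [e1, e2]
  congr 2
  conv_rhs => rw [← Multiset.map_id (unitRoots (2 * g'))]
  refine Multiset.map_congr rfl fun u _ => ?_
  simp only [Function.comp_apply, id]
  push_cast
  field_simp

/-- Power sums of the non-trivial roots of unity: `Σ_{j=1}^{n} ζ^{jd} = -1` for `0 < d ≤ n`. [folklore] -/
theorem powerSum_unitRoots {n d : ℕ} (hd : 0 < d) (hdn : d ≤ n) : powerSum (unitRoots n) d = -1 := by
  have hprim := zetaN_isPrimitiveRoot (Nat.succ_ne_zero n)
  set x : ℂ := zetaN (n + 1) ^ d with hx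
  have hx1 : x ≠ 1 := hprim.pow_ne_one_of_pos_of_lt hd.ne' (by omega)
  have hxN : x ^ (n + 1) = 1 := by
    rw [hx, ← pow_mul, mul_comm, pow_mul, zetaN_pow_self _ (Nat.succ_ne_zero n), one_pow]
  have hgeom : (∑ i ∈ Finset.range (n + 1), x ^ i) = 0 := by
    have h := geom_sum_mul x (n + 1)
    rw [hxN, sub_self] at h
    exact (mul_eq_zero.1 h).resolve_right (sub_ne_zero.2 hx1)
  rw [Finset.sum_range_succ', pow_zero] at hgeom
  rw [powerSum, unitRoots, Multiset.map_map, ← Finset.sum_eq_multiset_sum]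
  have : ∀ i ∈ Finset.range n, ((fun α : ℂ => α ^ d) ∘ fun i => zetaN (n + 1) ^ (i + 1)) i = x ^ (i + 1) := by
    intro i _
    simp only [Function.comp_apply, hx, ← pow_mul]
    ring_nf
  rw [Finset.sum_congr rfl this]
  linear_combination hgeom

/-- `Σ_{j=1}^{n} ζ^{0} = n`. [folklore] -/
theorem powerSum_unitRoots_zero (n : ℕ) : powerSum (unitRoots n) 0 = n := by
  simp [powerSum, unitRoots]

/-- The deviation `e(d) = r₊^d + r₋^d - 2 ≥ 0` of the off-circle pair from an on-circle pair. [folklore] -/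
def eDev (k d : ℕ) : ℝ := rPlus k ^ d + rMinus k ^ d - 2

/-- Real model of the entries: `T = ((2g'+1)/2)·1 + ½·J + ½·(e(|i-j|))`. [folklore] -/
def tEntry (g' k : ℕ) (i j : Fin (2 * g' + 1)) : ℝ :=
  (2 * g' + 1) / 2 * (if i = j then 1 else 0) + 1 / 2 + eDev k (Nat.dist i j) / 2

/-- ENTRY FORMULA: `T_{2g-2}(q, hAll)_{ij} = tEntry i j` (real). [folklore] -/
theorem windowForm_all_apply (g' : ℕ) {k : ℕ} (hk : k ≠ 0) (i j : Fin (2 * g' + 1)) :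
    ffWindowForm (qAll k : ℝ) (rootsAll g' k) (2 * g') i j = ((tEntry g' k i j : ℝ) : ℂ) := by
  rw [ffWindowForm, Matrix.of_apply, ffKernel, normRoots_rootsAll g' hk]
  have hsplit : ∀ d, powerSum (((rMinus k : ℝ) : ℂ) ::ₘ ((rPlus k : ℝ) : ℂ) ::ₘ unitRoots (2 * g')) d =
      ((rMinus k : ℝ) : ℂ) ^ d + ((rPlus k : ℝ) : ℂ) ^ d + powerSum (unitRoots (2 * g')) d := by
    intro d
    simp only [powerSum, Multiset.map_cons, Multiset.sum_cons]
    ring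
  rw [hsplit]
  by_cases hij : i = j
  · subst hij
    rw [Nat.dist_self, powerSum_unitRoots_zero, tEntry, if_pos rfl, Nat.dist_self, eDev]
    push_cast
    ring
  · have hd : 0 < Nat.dist i j := by
      rcases Nat.lt_or_gt_of_ne (fun h => hij (Fin.ext h)) with h | h
      · rw [Nat.dist_eq_sub_of_le h.le]; omega
      · rw [Nat.dist_eq_sub_of_le_right h.le]; omega
    have hdn : Nat.dist i j ≤ 2 * g' := by
      have hi := i.isLt; have hj := j.isLt
      unfold Nat.dist; omega
    rw [powerSum_unitRoots hd hdn, tEntry, if_neg hij, eDev]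
    push_cast
    ring

end Summit.RiemannHypothesis.RiemannHypothesis.Theorems.PfPersistence.FfAngleTwin

end
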